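import Mathlib
import HarnessLib
import Summits.ResolutionOfSingularities.ResolutionOfSingularities.Theorems.WildQuotientsWildQuotientResolutionBlowupExitBasicOpenSections
import Summits.ResolutionOfSingularities.ResolutionOfSingularities.Theorems.WildQuotientsWildQuotientResolutionPrincipalChartRees
import Summits.ResolutionOfSingularities.ResolutionOfSingularities.Theorems.WildQuotientsWildQuotientResolutionToricExitCentre

/-!
# The seam at the singular chart `V[x_a]` of `Bl_{(x_a, x_b²)} 𝔸ⁿ` (`J₃`, for the ring brick `Hₐ`)
(crux stmt-ResolutionOfSingularities-15640 `WildQuotients.WildQuotientResolution`, line `Sketch`;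
chain w45c programme V3U, `L/w45c/CHAIN.md` v7.7 §0/§4 — the `J₃` instantiation of
`BlowupExit.exists_basicOpen_sectionsEquiv` (p510259), stated against the LITERAL binders
`(ρ hρ ρB haut Oa hOa hle)` of the ring brick `Hₐ` of `ToricExit.coneBrick_a_of_ringBrick`
(res-L1-w45c-lead-1, p511455); written by res-D-pv-033 AS res-L1-w45c-stub-5 for res-type-035 (`Hₐ`);
[OURS · L1 W4.5c] — assembly of landed decls, NOT a statement of any manuscript.)

* `ToricExit.X_a_mem_centre` — `x_a ∈ I₂ = (x_a, x_b²)`;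
* `ToricExit.exists_reesGradedHom_family_centre` — the coefficientwise Rees automorphisms `φ g`
  (`g⁻¹` on coefficients) of `k[x][I₂ t]`, `g ∈ ⟨σ⟩`, with the `Proj.map` hypothesis and
  `φ g (x_a t) = x_a t`;
* `ToricExit.exists_sectionsEquiv_chartA` — for a stable affine open `Oa` of the `ActionOver` with
  `Oa.1 = V[x_a]`: `φ`, `hP`, and `Ωₐ : (R[I₂t])_{(x_a t)} ≃+* Γ(↥Oa.1, (Oa.1.ι ≫ π ≫ q)⁻¹ ⊤)` with
  (o) the coefficient law, (i') `(π^* f)|_{Oa} = Ωₐ (reesChartBase x_a f)` in the brick's `appLE`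
  spelling, (ii) the action law, (iii) `Ωₐ y ∈ invariantsRing ⊤ ↔ ∀ g, map (φ g) y = y`.
So `Hₐ` is reduced to algebra inside `(R[I₂t])_{(x_a t)}` (`ψ := Ωₐ ∘ ψC`; E-engine
`ToricExit.map_away_eq_of_intertwines`, p505671).
-/

-- single-problem summit: the doubled namespace component `ResolutionOfSingularities` is forced
set_option linter.dupNamespace false

noncomputable section

open CategoryTheory AlgebraicGeometry TopologicalSpace MvPolynomial Polynomial HomogeneousLocalization
open Literature.AlgebraicGeometry.Resolution Literature.AlgebraicGeometry.RelativeSpec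
open scoped Pointwise

namespace Summit.ResolutionOfSingularities.ResolutionOfSingularities.Theorems.WildQuotientResolution.ToricExit

variable (k : Type) [Field k] (n : ℕ) (σ : MvPolynomial (Fin n) k ≃ₐ[k] MvPolynomial (Fin n) k)
  (a b c : Fin n) (hab : a ≠ b) (hac : a ≠ c)
  (hb : σ (X b) = X b + X a) (hσ : ∀ i, i ≠ b → i ≠ c → σ (X i) = X i)

/-- the generator vector of `I₂` (local shorthand; unfolds at elaboration) -/
local notation3 "g2" => (![X a, X b ^ 2] : Fin 2 → MvPolynomial (Fin n) k)
/-- `I₂` (local shorthand) -/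
local notation3 "I2" => Ideal.span (Set.range g2)
/-- `ι₀ : k[x] → Γ(Spec k[x], ⊤)` (local shorthand) -/
local notation3 "ι₀" => (Scheme.ΓSpecIso (CommRingCat.of (MvPolynomial (Fin n) k))).inv.hom
/-- the quotient map `q : 𝔸ⁿ → 𝔸ⁿ/⟨σ⟩` (local shorthand) -/
local notation3 "qσ" => Spec.map (CommRingCat.ofHom (algebraMap
  (FixedPoints.subalgebra k (MvPolynomial (Fin n) k) (Subgroup.zpowers σ)) (MvPolynomial (Fin n) k)))

/-- `x_a ∈ I₂` (generator `0`). [folklore] -/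
theorem X_a_mem_centre : (X a : MvPolynomial (Fin n) k) ∈ I2 :=
  Ideal.subset_span ⟨0, rfl⟩

include hab hac hb hσ in
/-- **The `φ`-family for `I₂`**: coefficientwise `g⁻¹` graded automorphisms of `k[x][I₂ t]`, with the
`Proj.map` hypothesis, fixing the chart section `x_a t`. [OURS · L1 W4.5c]
[folklore; assembly of landed decls] -/
theorem exists_reesGradedHom_family_centre :
    ∃ φ : ↥(Subgroup.zpowers σ) → (reesGrading I2 →+*ᵍ reesGrading I2),
      (∀ (g : ↥(Subgroup.zpowers σ)) x, ((φ g x : reesAlgebra I2) : (MvPolynomial (Fin n) k)[X]) =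
        (x : (MvPolynomial (Fin n) k)[X]).map ((MulSemiringAction.toRingEquiv (↥(Subgroup.zpowers σ))
          (MvPolynomial (Fin n) k) g⁻¹ : _ ≃+* _) : _ →+* _)) ∧
      (∀ g, HomogeneousIdeal.irrelevant (reesGrading I2) ≤
        (HomogeneousIdeal.irrelevant (reesGrading I2)).map (φ g)) ∧
      (∀ g, φ g (reesT (X a : MvPolynomial (Fin n) k) (X_a_mem_centre k n a b)) =
        reesT (X a : MvPolynomial (Fin n) k) (X_a_mem_centre k n a b)) := by
  have H := BlowupExit.exists_reesGradedHom_family (I := I2)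
    (smul_centre_pointwise k n σ a b c hab hac hb hσ)
  rcases H with ⟨φ, hφ, hf⟩
  refine ⟨φ, hφ, hf, fun g => ?_⟩
  refine BlowupExit.reesGradedHom_eq_self_of_monomial _ (X a) (coe_reesT _ _) (φ g) _ (hφ g) ?_
  change (MulSemiringAction.toRingEquiv _ _ g⁻¹) (X a) = X a
  rw [MulSemiringAction.toRingEquiv_apply_apply]
  -- `g⁻¹ • x_a = x_a`
  have hσ' : σ • (X a : MvPolynomial (Fin n) k) = X a := hσ a hab hac
  obtain ⟨z, hz⟩ := Subgroup.mem_zpowers_iff.mp (g⁻¹).2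
  change ((g⁻¹ : ↥(Subgroup.zpowers σ)) : MvPolynomial (Fin n) k ≃ₐ[k] MvPolynomial (Fin n) k) •
    (X a : MvPolynomial (Fin n) k) = X a
  rw [← hz]
  exact MulAction.fixedBy_subset_fixedBy_zpow (MvPolynomial (Fin n) k) σ z hσ'

include hab hac hb hσ in
-- the statement is long (literal binder types of the scaffold); elaboration needs head-room
set_option maxHeartbeats 4000000 in
/-- **The seam at `V[x_a]` (for `Hₐ`).** For the binders `(ρ hρ ρB haut Oa hOa hle)` of the ring
brick `Hₐ` of `ToricExit.coneBrick_a_of_ringBrick`: the `φ`-family, `hP`, and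
`Ωₐ : (R[I₂t])_{(x_a t)} ≃+* Γ(↥Oa.1, (Oa.1.ι ≫ π ≫ q)⁻¹ ⊤)` with (o) coefficient law,
(i') `(π^* f)|_{Oa} = Ωₐ (reesChartBase x_a f)`, (ii) action law, (iii) invariants `↔` fixed by all
`map (φ g)`. [OURS · L1 W4.5c] [folklore; assembly of landed decls] -/
theorem exists_sectionsEquiv_chartA
    (ρ : ↥(Subgroup.zpowers σ) →* Aut (Spec (CommRingCat.of (MvPolynomial (Fin n) k))))
    (hρ : ∀ g : ↥(Subgroup.zpowers σ), (ρ g).hom = Spec.map (CommRingCat.ofHom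
      ((MulSemiringAction.toRingEquiv (↥(Subgroup.zpowers σ)) (MvPolynomial (Fin n) k) g⁻¹ :
        MvPolynomial (Fin n) k ≃+* MvPolynomial (Fin n) k) :
          MvPolynomial (Fin n) k →+* MvPolynomial (Fin n) k)))
    (ρB : ActionOver (affineBlowup.π I2 ≫ qσ) ↥(Subgroup.zpowers σ))
    (haut : ρB.aut = (affineBlowup.isBlowup I2).liftAction ρ
      (idealSheaf_centre_comap k n σ a b c hab hac hb hσ ρ hρ))
    (Oa : ρB.StableAffineOpens)
    (hOa : Oa.1 = blowupChart (affineBlowup.π I2) (affineBlowup.idealSheaf I2)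
      ⟨⊤, isAffineOpen_top _⟩ (ι₀ (X a)))
    (hle : ((Oa.1.ι ≫ affineBlowup.π I2 ≫ qσ) ⁻¹ᵁ ⊤ : (Oa.1 : Scheme.{0}).Opens) ≤
      Oa.1.ι ⁻¹ᵁ blowupChart (affineBlowup.π I2) (affineBlowup.idealSheaf I2)
        ⟨⊤, isAffineOpen_top _⟩ (ι₀ (X a))) :
    ∃ (φ : ↥(Subgroup.zpowers σ) → (reesGrading I2 →+*ᵍ reesGrading I2))
      (hP : ∀ g, Submonoid.powers (reesT (X a : MvPolynomial (Fin n) k) (X_a_mem_centre k n a b)) ≤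
        (Submonoid.powers (reesT (X a : MvPolynomial (Fin n) k) (X_a_mem_centre k n a b))).comap
          (φ g))
      (Ω : HomogeneousLocalization.Away (reesGrading I2)
          (reesT (X a : MvPolynomial (Fin n) k) (X_a_mem_centre k n a b)) ≃+*
        Γ((Oa.1 : Scheme.{0}), (Oa.1.ι ≫ affineBlowup.π I2 ≫ qσ) ⁻¹ᵁ ⊤)),
      (∀ (g : ↥(Subgroup.zpowers σ)) x, ((φ g x : reesAlgebra I2) : (MvPolynomial (Fin n) k)[X]) =
        (x : (MvPolynomial (Fin n) k)[X]).map ((MulSemiringAction.toRingEquiv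
          (↥(Subgroup.zpowers σ)) (MvPolynomial (Fin n) k) g⁻¹ : _ ≃+* _) : _ →+* _)) ∧
      (∀ f : MvPolynomial (Fin n) k,
        Oa.1.ι.appLE (blowupChart (affineBlowup.π I2) (affineBlowup.idealSheaf I2)
            ⟨⊤, isAffineOpen_top _⟩ (ι₀ (X a)))
          ((Oa.1.ι ≫ affineBlowup.π I2 ≫ qσ) ⁻¹ᵁ ⊤) hle
          ((affineBlowup.π I2).appLE ⊤ (blowupChart (affineBlowup.π I2) (affineBlowup.idealSheaf I2)
            ⟨⊤, isAffineOpen_top _⟩ (ι₀ (X a))) (blowupChart_le_preimage _ _ _ _) (ι₀ f)) =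
        Ω (reesChartBase (X a : MvPolynomial (Fin n) k) (X_a_mem_centre k n a b) f)) ∧
      (∀ (g : ↥(Subgroup.zpowers σ)) y, (ρB.restrict Oa.1 Oa.2.1).act g ⊤ (Ω y) =
        Ω (HomogeneousLocalization.map (φ g⁻¹) (hP g⁻¹) y)) ∧
      (∀ y, Ω y ∈ (ρB.restrict Oa.1 Oa.2.1).invariantsRing ⊤ ↔
        ∀ g, HomogeneousLocalization.map (φ g) (hP g) y = y) := by
  have H := exists_reesGradedHom_family_centre k n σ a b c hab hac hb hσ
  rcases H with ⟨φ, hφ, hf, hφa⟩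
  have h0 := X_a_mem_centre k n a b
  have hP : ∀ g, Submonoid.powers (reesT (X a : MvPolynomial (Fin n) k) h0) ≤
      (Submonoid.powers (reesT (X a : MvPolynomial (Fin n) k) h0)).comap (φ g) := by
    intro g
    rintro _ ⟨m, rfl⟩
    exact ⟨m, by change _ ^ m = φ g (_ ^ m); rw [map_pow, hφa g]⟩
  have hOs : Oa.1 = Proj.basicOpen (reesGrading I2) (reesT (X a : MvPolynomial (Fin n) k) h0) :=
    hOa.trans (blowupChart_affineBlowup_eq_basicOpen_reesT (X a) h0)
  have H2 := BlowupExit.exists_basicOpen_sectionsEquiv ρ hρ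
    (idealSheaf_centre_comap k n σ a b c hab hac hb hσ ρ hρ) qσ ρB (fun g => by rw [haut])
    (reesT (X a : MvPolynomial (Fin n) k) h0) (reesT_mem _ _) one_pos φ hφ hf hφa hP
    Oa.1 Oa.2.1 hOs
  rcases H2 with ⟨Ω, hΩi, hΩii⟩
  refine ⟨φ, hP, Ω, hφ, fun f => ?_, hΩii, fun y => ?_⟩
  · -- (i') from (i) by composing the two `appLE`s
    rw [← CommRingCat.comp_apply, Scheme.Hom.appLE_comp_appLE]
    exact (hΩi f).symm
  · exact BlowupExit.mem_invariantsRing_iff_of_sectionsEquiv qσ ρB _ φ hP Oa.1 Oa.2.1 Ω hΩii y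

end Summit.ResolutionOfSingularities.ResolutionOfSingularities.Theorems.WildQuotientResolution.ToricExit

end
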